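import Literature.IUT.HodgeArakelov.LabelClassesOfCusps
import Literature.IUT.HodgeTheaters.TemperedCoverings
import HarnessLib

/-!
# Bridge B13: the `±`-tower of [IUTchII] Def 2.3 (i) over the [IUTchI] §2 stable-curve tempered data, and Cor 2.5 transported

Mochizuki, *Inter-universal Teichmüller Theory II*, kurims manuscript (Dec. 2020), §2, Def 2.3 (i) p.67 and the proof
of Cor 2.4 (i), p.70 l.−9 – p.71 l.6; *Inter-universal Teichmüller Theory I*, kurims manuscript (May 2020), §2,
Prop 2.4 (iii) p.49, Cor 2.5 p.51, Rmk 2.5.2 p.52 [cite: Mochizuki2012, II Def 2.3 (i) p.67, II Cor 2.4 (i) pp.70–71, I Cor 2.5 p.51]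
(D-0012 claim key, status disputed; this is a BRIDGE between two landed typings — NOTHING of the series is asserted:
every printed input stays a hypothesis, named by the tree's L5 declarations).

MERGE-MAP plan/L6/MERGE-MAP.md §8 **B13** (request of abc-iut-w4-d012, GAP-LEDGER row G-w4d012-1): abc-iut-L6-t1's
`PlusMinusTower T` ([IUTchII] Def 2.3 (i): `Π_v ⊆ Π^±_v ⊆ Π^cor_v`, `Π̂_v ⊆ Π̂^±_v ⊆ Π̂^cor_v`, all inside one ambient group
`Π̂^cor_v`) and abc-iut-L5-t1's `StableCurveTemperedData` ([IUTchI] §2: `Π^tp_X ↪ Π̂_X ↠ G_k`, cusps with representative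
inertia groups; Cor 2.3, Prop 2.4, Cor 2.5 typed as predicates `Cor23v`, `Prop24iii`, `Cor25Inertia`, …) speak about the
SAME objects for `X = X_v`: "`Π^±_v := Π^tp_{X_v}`", "`Π̂^±_v := Π̂_{X_v}`" (Def 2.3 (i) p.67).  This file records that
identification as an explicit AGREEMENT structure and TRANSPORTS [IUTchI] Cor 2.5 (inertia part, "by Remark 2.5.2 the
only part applied in [IUTchII]") along it:

* `PlusMinusTower.StableCurveAgreement W C D` — `eHat : Π̂^±_v ≃* Π̂_{X_v}` carrying `Π^±_v` onto the image of
  `Π^tp_{X_v}`, `Δ̂^±_v` onto `Δ̂_{X_v}`, and the tempered cuspidal inertia subgroups of `Π^±_v` (abc-iut-L6-t1's abstract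
  `CuspidalInertiaData`) onto the `Π^tp_{X_v}`-conjugates of the representative inertia groups `I_x`;
* **`PlusMinusTower.StableCurveAgreement.h25`** — from [IUTchI] Cor 2.5 (`D.Cor25Inertia`) and the normal terminality of
  `Π^tp_{X_v}` in `Π̂_{X_v}` (Prop 2.4 (iii), `D.Prop24iii`, via `IsCommensurablyTerminal.isNormallyTerminal`), BOTH AS
  HYPOTHESES: "the inclusion `I^{γ'}_t ⊆ Π^±_v` implies that `γ' ∈ Δ^±_v`" for `γ' ∈ Δ̂^±_v` — LITERALLY hypothesis
  `h25` of abc-iut-w4-d012's `cor24_i_of_inputs` (`LabelClassesOfCuspsCor24iProofs.lean`), which thereby becomes a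
  one-line instance of the two [IUTchI] §2 nodes.  Part 2 (same file): **`StableCurveAgreement.h23v`** — with the `ℍ`-dictionary
  `SubgraphDictionary` (`Δ^±_{v□} = Δ^tp_{X,ℍ}`, `eHat` bicontinuous), [IUTchI] Cor 2.3 (ii) (`D.Cor23ii`) and (v) (`D.Cor23v`)
  give LITERALLY hypothesis `h23v`; `cor24_i_inputs_of_agreement` packages both — only `h23vi` (the open-subgroup
  ARGUMENT, GAP-LEDGER G-w4d012-2) then stands between the cone node `IUTchII:Cor2.4(i)` and typed [IUTchI] §2 statements.
-/

namespace Literature.IUT.HodgeArakelov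

open Literature.IUT.HodgeTheaters
open Literature.AnabelianGeometry.AbsoluteAnabelian (IsCommensurablyTerminal IsNormallyTerminal)
open scoped Pointwise

universe u

variable {S : BadPlaceSetting.{u}} {P : TopGroup.{u}} {T : TemperedCoverings S P}

namespace PlusMinusTower

/-! ### Plain group theory: conjugation inside a subgroup, transported along an isomorphism -/

section GroupTheory

variable {G G' : Type u} [Group G] [Group G']

/-- **IUTchII:Def2.3(i)** (kurims p.67) abc-iut-L6-t1's spelling `I.map (MulAut.conj γ).toMonoidHom` of the conjugate `I^γ` IS Mathlib's pointwise
conjugate `MulAut.conj γ • I` (definitional). [claim: Mochizuki2012, status: disputed] -/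
theorem map_conj_eq_smul (I : Subgroup G) (γ : G) :
    I.map (MulAut.conj γ).toMonoidHom = MulAut.conj γ • I := rfl

/-- **IUTchI:Cor2.5** (kurims p.51) Transport of conjugates along an isomorphism out of a subgroup `Q ⊆ G`: for `γ ∈ Q`, the image in `G'`
of `(I^γ) ∩ Q` is the conjugate, by the image of `γ`, of the image of `I ∩ Q`. [claim: Mochizuki2012, status: disputed] -/
theorem map_subgroupOf_conj {Q : Subgroup G} (e : Q ≃* G') (I : Subgroup G) {γ : G} (hγ : γ ∈ Q) :
    ((MulAut.conj γ • I).subgroupOf Q).map e.toMonoidHom =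
      MulAut.conj (e ⟨γ, hγ⟩) • (I.subgroupOf Q).map e.toMonoidHom := by
  ext y
  simp only [Subgroup.mem_map, Subgroup.mem_subgroupOf, MulEquiv.coe_toMonoidHom,
    Subgroup.mem_pointwise_smul_iff_inv_smul_mem, MulAut.smul_def, MulAut.conj_inv_apply]
  constructor
  · rintro ⟨q, hq, rfl⟩
    -- `q ∈ Q` with `γ⁻¹ q γ ∈ I`
    refine ⟨⟨γ⁻¹ * q * γ, Q.mul_mem (Q.mul_mem (Q.inv_mem hγ) q.2) hγ⟩, hq, ?_⟩
    have : (⟨γ⁻¹ * ↑q * γ, Q.mul_mem (Q.mul_mem (Q.inv_mem hγ) q.2) hγ⟩ : Q) =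
        ⟨γ, hγ⟩⁻¹ * q * ⟨γ, hγ⟩ := rfl
    rw [this, map_mul, map_mul, map_inv]
  · rintro ⟨q, hq, hqe⟩
    -- `q ∈ Q` with `q ∈ I` and `e q = (e γ)⁻¹ * y * (e γ)`; then `y = e (γ q γ⁻¹)`
    have hmem : γ * ↑q * γ⁻¹ ∈ Q := Q.mul_mem (Q.mul_mem hγ q.2) (Q.inv_mem hγ)
    refine ⟨⟨γ * q * γ⁻¹, hmem⟩, ?_, ?_⟩
    · show γ⁻¹ * (γ * ↑q * γ⁻¹) * γ ∈ I
      simpa [mul_assoc] using hq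
    · have : (⟨γ * ↑q * γ⁻¹, hmem⟩ : Q) = ⟨γ, hγ⟩ * q * ⟨γ, hγ⟩⁻¹ := rfl
      rw [this, map_mul, map_mul, map_inv, hqe]
      group

/-- **IUTchI:Cor2.5** (kurims p.51) Monotonicity of the transport: `I ≤ J` implies the images in `G'` of `I ∩ Q ⊆ J ∩ Q` are nested.
[claim: Mochizuki2012, status: disputed] -/
theorem map_subgroupOf_mono {Q : Subgroup G} (e : Q ≃* G') {I J : Subgroup G} (h : I ≤ J) :
    (I.subgroupOf Q).map e.toMonoidHom ≤ (J.subgroupOf Q).map e.toMonoidHom :=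
  Subgroup.map_mono fun _ hq => h hq

/-- **IUTchI:Prop2.4(iii)** (kurims p.49) A normally terminal subgroup contains every element that conjugates it onto itself
(pointwise form). [claim: Mochizuki2012, status: disputed] -/
theorem mem_of_conj_smul_eq {K : Subgroup G'} (hK : IsNormallyTerminal K) {g : G'}
    (h : MulAut.conj g • K = K) : g ∈ K := by
  rw [← hK.normalizer_eq]
  rw [Subgroup.mem_normalizer_iff]
  intro x
  rw [← SetLike.ext_iff.mp h (g * x * g⁻¹), Subgroup.mem_pointwise_smul_iff_inv_smul_mem]
  simp [MulAut.smul_def, mul_assoc]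

end GroupTheory

/-! ### The agreement structure -/

/-- **IUTchII:Def2.3(i)** (kurims p.67) AGREEMENT between abc-iut-L6-t1's `±`-tower `W` at `v ∈ 𝕍^bad` (with its abstract cuspidal-inertia notion
`C`) and abc-iut-L5-t1's [IUTchI] §2 data `D` for the curve `X = X_v`: "`Π^±_v := Π^tp_{X_v}`, `Π̂^±_v := Π̂_{X_v}`" —
an isomorphism `eHat : Π̂^±_v ⥲ Π̂_{X_v}` (of abstract groups; part 2 adds bicontinuity) carrying `Π^±_v` onto the image
of `Π^tp_{X_v} ↪ Π̂_{X_v}`, `Δ̂^±_v = Π̂^±_v ∩ Ker(↠ G_v)` onto `Δ̂_{X_v}`, and identifying the cuspidal inertia subgroups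
of `Π^±_v` with the `Π^tp_{X_v}`-conjugates of the representative inertia groups `I_x ⊆ Δ^tp_{X_v}` of the cusps.
A hypothesis structure (the common model — [IUTchI] Def 3.1 (e) — instantiates it); nothing asserted.
[claim: Mochizuki2012, status: disputed] -/
structure StableCurveAgreement (W : PlusMinusTower T) (C : CuspidalInertiaData W)
    (D : StableCurveTemperedData.{u}) where
  /-- `Π̂^±_v ⥲ Π̂_{X_v}` -/
  eHat : W.pmHat ≃* D.PiHat
  /-- `Π^±_v ⊆ Π̂^±_v` is carried onto `Π^tp_{X_v} ↪ Π̂_{X_v}` -/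
  map_piPM : (W.piPM.subgroupOf W.pmHat).map eHat.toMonoidHom = D.ιX.range
  /-- `Δ̂^±_v` is carried onto `Δ̂_{X_v} = Ker(Π̂_{X_v} ↠ G_k)` -/
  mem_ker_iff : ∀ g : W.pmHat, (g : W.Corhat) ∈ W.aug.ker ↔ eHat g ∈ D.DeltaHat
  /-- the cuspidal inertia subgroups of `Π^±_v` are the `Π^tp_{X_v}`-conjugates of the `I_x` -/
  inertia_iff : ∀ I : Subgroup W.Corhat, C.IsCuspidalInertia W.piPM I ↔
    I ≤ W.piPM ∧ ∃ (x : D.Cusp) (t : D.PiTp), (I.subgroupOf W.pmHat).map eHat.toMonoidHom =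
      (MulAut.conj t • (D.inertiaTp x).map D.DeltaTp.subtype).map D.ιX

namespace StableCurveAgreement

variable {W : PlusMinusTower T} {C : CuspidalInertiaData W} {D : StableCurveTemperedData.{u}}

/-- **IUTchII:Def2.3(i)** (kurims p.67) Under the agreement an element of `Π̂^±_v` lies in `Π^±_v` iff its image lies in (the image of) `Π^tp_{X_v}`.
[claim: Mochizuki2012, status: disputed] -/
theorem mem_piPM_iff (A : StableCurveAgreement W C D) (g : W.pmHat) : (g : W.Corhat) ∈ W.piPM ↔ A.eHat g ∈ D.ιX.range := by
  rw [← A.map_piPM, Subgroup.mem_map]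
  constructor
  · intro hg
    exact ⟨g, Subgroup.mem_subgroupOf.mpr hg, rfl⟩
  · rintro ⟨q, hq, hqe⟩
    rw [MulEquiv.coe_toMonoidHom, A.eHat.apply_eq_iff_eq] at hqe
    subst hqe
    exact Subgroup.mem_subgroupOf.mp hq

/-- **IUTchI:Cor2.5** (kurims p.51) **Cor 2.5 transported = hypothesis `h25` of `cor24_i_of_inputs`.** From [IUTchI] Cor 2.5 (inertia part; for `Σ̂ = 𝔓𝔯𝔦𝔪𝔢𝔰`)
and the normal terminality of `Π^tp_{X_v}` in `Π̂_{X_v}` ([IUTchI] Prop 2.4 (iii)) — BOTH HYPOTHESES, in abc-iut-L5-t1's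
vocabulary — the agreement yields, for every cuspidal inertia subgroup `I ⊆ Π^±_v` and every `γ' ∈ Δ̂^±_v`:
"the inclusion `I^{γ'} ⊆ Π^±_v` implies that `γ' ∈ Δ^±_v`" ([IUTchII] Cor 2.4 (i), proof, p.70: "by [IUTchI], Corollary 2.5
[cf. also [IUTchI], Remark 2.5.2]").  PROVED. [claim: Mochizuki2012, status: disputed] -/
theorem h25 (A : StableCurveAgreement W C D) (hSig : D.graph.SigmaHat = {q | q.Prime})
    (h25D : D.Cor25Inertia) (hNT : IsNormallyTerminal D.ιX.range) {I : Subgroup W.Corhat}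
    (hI : C.IsCuspidalInertia W.piPM I) :
    ∀ γ' : W.Corhat, γ' ∈ W.pmHat ⊓ W.aug.ker →
      I.map (MulAut.conj γ').toMonoidHom ≤ W.piPM → γ' ∈ W.piPM := by
  intro γ' hγ' hc
  obtain ⟨-, x, t, hIx⟩ := (A.inertia_iff I).mp hI
  have hγ'pm : γ' ∈ W.pmHat := (Subgroup.mem_inf.mp hγ').1
  set g : D.PiHat := A.eHat ⟨γ', hγ'pm⟩ with hg
  -- transport `I^{γ'} ⊆ Π^±_v` along `eHat`
  have hle : MulAut.conj g • ((MulAut.conj t • (D.inertiaTp x).map D.DeltaTp.subtype).map D.ιX) ≤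
      D.ιX.range := by
    rw [← hIx, hg, ← map_subgroupOf_conj A.eHat I hγ'pm, ← A.map_piPM,
      ← map_conj_eq_smul]
    exact map_subgroupOf_mono A.eHat hc
  -- Cor 2.5: a conjugate of `Π^tp_X` containing a tempered cuspidal inertia group is `Π^tp_X`
  have heq : MulAut.conj g⁻¹ • D.ιX.range = D.ιX.range := by
    refine (h25D.conj_eq_iff hSig g⁻¹).mp ⟨x, t, ?_⟩
    rwa [map_inv, ← Subgroup.pointwise_smul_subset_iff]
  -- normal terminality: then `g⁻¹`, hence `g`, lies in `Π^tp_X`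
  have hg' : g ∈ D.ιX.range := by
    have := mem_of_conj_smul_eq hNT heq
    simpa using D.ιX.range.inv_mem this
  exact (A.mem_piPM_iff ⟨γ', hγ'pm⟩).mpr hg'

/-- **IUTchI:Prop2.4(iii)** (kurims p.49) The same with the normal terminality supplied by abc-iut-L5-t1's typed Prop 2.4 (iii) (`D.Prop24iii`:
`Π^tp_X ⊆ Π̂_X` commensurably, hence normally, terminal). PROVED. [claim: Mochizuki2012, status: disputed] -/
theorem h25_of_prop24iii (A : StableCurveAgreement W C D) (hSig : D.graph.SigmaHat = {q | q.Prime})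
    (h25D : D.Cor25Inertia) (h24 : D.Prop24iii) {I : Subgroup W.Corhat}
    (hI : C.IsCuspidalInertia W.piPM I) :
    ∀ γ' : W.Corhat, γ' ∈ W.pmHat ⊓ W.aug.ker →
      I.map (MulAut.conj γ').toMonoidHom ≤ W.piPM → γ' ∈ W.piPM :=
  A.h25 hSig h25D h24.pi.isNormallyTerminal hI


/-! ### Part 2: [IUTchI] Cor 2.3 (ii) + (v) transported = hypothesis `h23v` of `cor24_i_of_inputs` -/

/-- **IUTchII:Def2.3(i)** (kurims p.67) `Δ^±_{v□} ⊆ Π̂^±_v`: abc-iut-L6-t1's `W.deltaPmBox H = N_{Π^±_v}(Π_{v□}) ∩ Δ̂^cor_v` lies in `Π^±_v ⊆ Π̂^±_v`.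
[claim: Mochizuki2012, status: disputed] -/
theorem _root_.Literature.IUT.HodgeArakelov.PlusMinusTower.deltaPmBox_le_pmHat (W : PlusMinusTower T)
    (H : Subgroup P) : W.deltaPmBox H ≤ W.pmHat :=
  fun _ hx => W.emb_le_pmHat ((Subgroup.map_subtype_le _) (Subgroup.mem_inf.mp hx).1)

/-- **IUTchII:Def2.3(i)** (kurims p.67) The `ℍ`-DICTIONARY of the agreement for one subgroup `Π_{v□} ⊆ Π_v` (print: `□ ∈ {•t, ▶}`, the
decomposition groups of the subgraphs `Γ_{•t}`, `Γ^▶_X` of Def 2.3 (iv) / Rmk 2.1.1, to which [IUTchI] Cor 2.3 applies with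
`X = X_v`, `ℍ = ` the corresponding subgraph): `Δ^±_{v□} = Δ^tp_{X_v,ℍ}` inside `Π̂^±_v = Π̂_{X_v}`, and `eHat` bicontinuous
(so that the closure "`∧`" of [IUTchII] p.71 — "the closure in `Δ̂^±_v`" — is abc-iut-L5-t1's `topologicalClosure`).
A hypothesis structure; nothing asserted. [claim: Mochizuki2012, status: disputed] -/
structure SubgraphDictionary (A : StableCurveAgreement W C D) (H : Subgroup P) : Prop where
  /-- `Δ^±_{v□} ⊆ Π̂^±_v` is carried onto `Δ^tp_{X,ℍ} ↪ Δ̂_X ⊆ Π̂_X` -/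
  deltaPmBox_eq : ((W.deltaPmBox H).subgroupOf W.pmHat).map A.eHat.toMonoidHom =
    (D.deltaTpH.map D.ιΔ).map D.DeltaHat.subtype
  /-- `eHat : Π̂^±_v ⥲ Π̂_{X_v}` is a homeomorphism (subspace topology on `Π̂^±_v ⊆ Π̂^cor_v`) -/
  isHomeomorph : IsHomeomorph A.eHat

/-- **IUTchI:Cor2.3(v)** (kurims p.48) **Cor 2.3 (ii)+(v) transported = hypothesis `h23v` of `cor24_i_of_inputs`.** From [IUTchI] Cor 2.3 (ii) (`D.Cor23ii`:
the closure of `Δ^tp_{X,ℍ}` in `Δ̂_X` is `Δ̂_{X,ℍ}`) and Cor 2.3 (v) (`D.Cor23v`: `Δ̂_{X,ℍ} ∩ Δ^tp_X = Δ^tp_{X,ℍ}`) — BOTH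
HYPOTHESES, in abc-iut-L5-t1's vocabulary — the agreement with its `ℍ`-dictionary yields, for `γ' ∈ Δ^±_v = Π^±_v ∩ Δ̂^cor_v`:
"`γ' ∈ Δ̂^±_{v□}` [the closure] … hence `γ' ∈ Δ^±_{v□} = Δ̂^±_{v□} ∩ Δ^±_v` [cf. [IUTchI], Corollary 2.3, (v)]" ([IUTchII]
Cor 2.4 (i), proof, p.71) — LITERALLY hypothesis `h23v` of abc-iut-w4-d012's `cor24_i_of_inputs`.  PROVED.
[claim: Mochizuki2012, status: disputed] -/
theorem h23v (A : StableCurveAgreement W C D) {H : Subgroup P} (Dic : A.SubgraphDictionary H)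
    (h23ii : D.Cor23ii) (h23vD : D.Cor23v) :
    ∀ γ' : W.Corhat, γ' ∈ W.piPM ⊓ W.aug.ker →
      γ' ∈ closure (W.deltaPmBox H : Set W.Corhat) → γ' ∈ W.deltaPmBox H := by
  intro γ' hγ' hcl
  obtain ⟨hγ'pm', hγ'ker⟩ := Subgroup.mem_inf.mp hγ'
  have hγ'pm : γ' ∈ W.pmHat := W.emb_le_pmHat hγ'pm'
  set g : D.PiHat := A.eHat ⟨γ', hγ'pm⟩ with hg
  have hgΔ : g ∈ D.DeltaHat := (A.mem_ker_iff ⟨γ', hγ'pm⟩).mp hγ'ker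
  have hgX : g ∈ D.ιX.range := (A.mem_piPM_iff ⟨γ', hγ'pm⟩).mp hγ'pm'
  -- (1) the closure, read inside the subspace `Π̂^±_v`
  set Sset : Set W.pmHat := Subtype.val ⁻¹' (W.deltaPmBox H : Set W.Corhat) with hSset
  have h1 : (⟨γ', hγ'pm⟩ : W.pmHat) ∈ closure Sset := by
    rw [closure_subtype]
    have hsub0 : (W.deltaPmBox H : Set W.Corhat) ⊆ Subtype.val '' Sset :=
      fun x hx => ⟨⟨x, W.deltaPmBox_le_pmHat H hx⟩, hx, rfl⟩
    exact closure_mono hsub0 hcl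
  -- (2) transported along the (continuous) identification `eHat`
  have h2 : g ∈ closure (A.eHat '' Sset) :=
    image_closure_subset_closure_image Dic.isHomeomorph.continuous ⟨_, h1, rfl⟩
  have hsub : A.eHat '' Sset ⊆
      Subtype.val '' ((D.deltaTpH.map D.ιΔ : Subgroup D.DeltaHat) : Set D.DeltaHat) := by
    rintro _ ⟨s, hs, rfl⟩
    have hmem : A.eHat s ∈ ((W.deltaPmBox H).subgroupOf W.pmHat).map A.eHat.toMonoidHom :=
      ⟨s, Subgroup.mem_subgroupOf.mpr hs, rfl⟩
    rw [Dic.deltaPmBox_eq] at hmem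
    obtain ⟨z, hz, hzs⟩ := hmem
    exact ⟨z, hz, hzs⟩
  have h2' : g ∈ closure (Subtype.val '' ((D.deltaTpH.map D.ιΔ : Subgroup D.DeltaHat) : Set D.DeltaHat)) :=
    closure_mono hsub h2
  -- (3) Cor 2.3 (ii): inside `Δ̂_X` the closure of `Δ^tp_{X,ℍ}` is `Δ̂_{X,ℍ}`
  have h3 : (⟨g, hgΔ⟩ : D.DeltaHat) ∈ D.deltaHatH := by
    rw [← h23ii.closure_eq, ← SetLike.mem_coe, Subgroup.topologicalClosure_coe, closure_subtype]
    exact h2'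
  -- (4) `g ∈ Δ^tp_X` (it comes from `Π^±_v = Π^tp_{X_v}` and maps to `1 ∈ G_k`)
  have h4 : (⟨g, hgΔ⟩ : D.DeltaHat) ∈ D.ιΔ.range := by
    obtain ⟨p, hp⟩ := hgX
    have hpΔ : p ∈ D.DeltaTp := by
      rw [MonoidHom.mem_ker, ← D.prHat_comp, MonoidHom.comp_apply, hp]
      exact hgΔ
    exact ⟨⟨p, hpΔ⟩, Subtype.ext hp⟩
  -- (5) Cor 2.3 (v): `Δ̂_{X,ℍ} ∩ Δ^tp_X = Δ^tp_{X,ℍ}`; read back through `eHat`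
  have h5 : (⟨g, hgΔ⟩ : D.DeltaHat) ∈ D.deltaTpH.map D.ιΔ := by
    rw [← h23vD.inf_eq]; exact Subgroup.mem_inf.mpr ⟨h3, h4⟩
  have h6 : g ∈ ((W.deltaPmBox H).subgroupOf W.pmHat).map A.eHat.toMonoidHom := by
    rw [Dic.deltaPmBox_eq]
    exact ⟨⟨g, hgΔ⟩, h5, rfl⟩
  obtain ⟨q, hq, hqe⟩ := h6
  rw [MulEquiv.coe_toMonoidHom, hg, A.eHat.apply_eq_iff_eq] at hqe
  subst hqe
  exact Subgroup.mem_subgroupOf.mp hq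

/-- **IUTchII:Cor2.4(i)** (kurims pp.70–71) SUMMARY for the cone node `IUTchII:Cor2.4(i)`: under the agreement (+ `ℍ`-dictionary for `Π_{v□}`), hypotheses
`h25` and `h23v` of abc-iut-w4-d012's `cor24_i_of_inputs` ARE the [IUTchI] §2 nodes Cor 2.5 (+ Prop 2.4 (iii)) and
Cor 2.3 (ii)+(v) of abc-iut-L5-t1's `StableCurveTemperedData`, instantiated — so only `h23vi` (the open-subgroup
ARGUMENT of p.70 l.−2 – p.71 l.3, GAP-LEDGER G-w4d012-2) remains between that node and typed [IUTchI] §2 statements.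
PROVED (conjunction of `h25_of_prop24iii` and `h23v`). [claim: Mochizuki2012, status: disputed] -/
theorem cor24_i_inputs_of_agreement (A : StableCurveAgreement W C D) {H : Subgroup P}
    (Dic : A.SubgraphDictionary H) (hSig : D.graph.SigmaHat = {q | q.Prime}) (h25D : D.Cor25Inertia)
    (h24 : D.Prop24iii) (h23ii : D.Cor23ii) (h23vD : D.Cor23v) {I : Subgroup W.Corhat}
    (hI : C.IsCuspidalInertia W.piPM I) :
    (∀ γ' : W.Corhat, γ' ∈ W.pmHat ⊓ W.aug.ker →
        I.map (MulAut.conj γ').toMonoidHom ≤ W.piPM → γ' ∈ W.piPM) ∧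
      (∀ γ' : W.Corhat, γ' ∈ W.piPM ⊓ W.aug.ker →
        γ' ∈ closure (W.deltaPmBox H : Set W.Corhat) → γ' ∈ W.deltaPmBox H) :=
  ⟨A.h25_of_prop24iii hSig h25D h24 hI, A.h23v Dic h23ii h23vD⟩


/-! ### v2 (append-only): the Π-level `ℍ`-dictionary, and the Δ-level one DERIVED from it via [IUTchI] Cor 2.3 (iii) -/

/-- **IUTchII:Def2.3(i)** (kurims p.67) The Π-LEVEL `ℍ`-dictionary for one `Π_{v□} ⊆ Π_v` (used as a bare hypothesis `hBox` by abc-iut-w5-d184's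
`boxOntoGalois_of_cor23iii`): `Π^±_{v□} = N_{Π^±_v}(Π_{v□})` is carried by `eHat` onto `Π^tp_{X_v,ℍ} ↪ Π̂_{X_v}` (abc-iut-L5-t1's
`piTpXH`, the normaliser of `Δ^tp_{X,ℍ}`), and `eHat` is bicontinuous. A hypothesis structure; nothing asserted.
[claim: Mochizuki2012, status: disputed] -/
structure PiSubgraphDictionary (A : StableCurveAgreement W C D) (H : Subgroup P) : Prop where
  /-- `Π^±_{v□} ⊆ Π̂^±_v` is carried onto `Π^tp_{X,ℍ} ↪ Π̂_X` -/
  pmBox_eq : ((W.pmBox H).subgroupOf W.pmHat).map A.eHat.toMonoidHom = D.piTpXH.map D.ιX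
  /-- `eHat : Π̂^±_v ⥲ Π̂_{X_v}` is a homeomorphism -/
  isHomeomorph : IsHomeomorph A.eHat

/-- **IUTchI:Cor2.3(iii)** (kurims p.47) The Δ-level dictionary entry FOLLOWS from the Π-level one and [IUTchI] Cor 2.3 (iii) (exactness
`Π^tp_{X,ℍ} ∩ Δ^tp_X = Δ^tp_{X,ℍ}`, abc-iut-L5-t1's `Cor23iii.exact_tp`, under `Cor23Hyp`): `Δ^±_{v□} = Π^±_{v□} ∩ Δ̂^cor_v` is carried onto
`Δ^tp_{X,ℍ} ↪ Δ̂_X ⊆ Π̂_X`. PROVED. [claim: Mochizuki2012, status: disputed] -/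
theorem deltaPmBox_eq_of_pi (A : StableCurveAgreement W C D) {H : Subgroup P} (Dic : A.PiSubgraphDictionary H)
    (hHyp : D.Cor23Hyp) (h23iii : D.Cor23iii) :
    ((W.deltaPmBox H).subgroupOf W.pmHat).map A.eHat.toMonoidHom =
      (D.deltaTpH.map D.ιΔ).map D.DeltaHat.subtype := by
  have hex := (h23iii.exact_tp hHyp).1
  ext y
  constructor
  · rintro ⟨q, hq, rfl⟩
    obtain ⟨hqBox, hqker⟩ := Subgroup.mem_inf.mp (Subgroup.mem_subgroupOf.mp hq)
    -- `eHat q ∈ Π^tp_{X,ℍ}` (Π-level dictionary) and `eHat q ∈ Δ̂_X` (kernel compatibility)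
    have h1 : A.eHat q ∈ D.piTpXH.map D.ιX := by
      rw [← Dic.pmBox_eq]; exact ⟨q, Subgroup.mem_subgroupOf.mpr hqBox, rfl⟩
    have h2 : A.eHat q ∈ D.DeltaHat := (A.mem_ker_iff q).mp hqker
    obtain ⟨p, hp, hpq⟩ := h1
    have hpΔ : p ∈ D.DeltaTp := by
      rw [MonoidHom.mem_ker, ← D.prHat_comp, MonoidHom.comp_apply, hpq]; exact h2
    have hp' : p ∈ D.piTpXH ⊓ D.DeltaTp := Subgroup.mem_inf.mpr ⟨hp, hpΔ⟩
    rw [hex] at hp'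
    obtain ⟨d, hd, hdp⟩ := hp'
    refine ⟨D.ιΔ d, ⟨d, hd, rfl⟩, ?_⟩
    change D.ιX (d : D.PiTp) = _   -- `coe_ιΔ` is definitional
    rw [MulEquiv.coe_toMonoidHom, ← hpq, ← hdp]; rfl
  · rintro ⟨z, ⟨d, hd, rfl⟩, rfl⟩
    -- `ιX d ∈ Π^tp_{X,ℍ}` since `d ∈ Δ^tp_{X,ℍ} = Π^tp_{X,ℍ} ∩ Δ^tp_X`
    have hdX : (d : D.PiTp) ∈ D.piTpXH := by
      have : ((d : D.DeltaTp) : D.PiTp) ∈ D.piTpXH ⊓ D.DeltaTp := by rw [hex]; exact ⟨d, hd, rfl⟩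
      exact (Subgroup.mem_inf.mp this).1
    have h1 : D.ιX (d : D.PiTp) ∈ ((W.pmBox H).subgroupOf W.pmHat).map A.eHat.toMonoidHom := by
      rw [Dic.pmBox_eq]; exact ⟨_, hdX, rfl⟩
    obtain ⟨q, hq, hqe⟩ := h1
    have h2 : D.ιX (d : D.PiTp) ∈ D.DeltaHat := by
      rw [MonoidHom.mem_ker, ← MonoidHom.comp_apply, D.prHat_comp]; exact (d : D.DeltaTp).2
    have hqker : (q : W.Corhat) ∈ W.aug.ker := by
      refine (A.mem_ker_iff q).mpr ?_
      rw [MulEquiv.coe_toMonoidHom] at hqe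
      rw [hqe]; exact h2
    refine ⟨q, Subgroup.mem_subgroupOf.mpr (Subgroup.mem_inf.mpr ⟨Subgroup.mem_subgroupOf.mp hq, hqker⟩), ?_⟩
    rw [hqe]; rfl

/-- **IUTchI:Cor2.3(iii)** (kurims p.47) Hence a Π-level dictionary plus [IUTchI] Cor 2.3 (iii) gives the Δ-level `SubgraphDictionary` used by `h23v`.
PROVED. [claim: Mochizuki2012, status: disputed] -/
theorem SubgraphDictionary.of_pi (A : StableCurveAgreement W C D) {H : Subgroup P}
    (Dic : A.PiSubgraphDictionary H) (hHyp : D.Cor23Hyp) (h23iii : D.Cor23iii) : A.SubgraphDictionary H :=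
  ⟨A.deltaPmBox_eq_of_pi Dic hHyp h23iii, Dic.isHomeomorph⟩

/-- **IUTchII:Cor2.4(i)** (kurims pp.70–71) `h23v` from the Π-level dictionary: [IUTchI] Cor 2.3 (ii)+(iii)+(v) along the agreement give hypothesis `h23v` of
abc-iut-w4-d012's `cor24_i_of_inputs`. PROVED. [claim: Mochizuki2012, status: disputed] -/
theorem h23v_of_pi (A : StableCurveAgreement W C D) {H : Subgroup P} (Dic : A.PiSubgraphDictionary H)
    (hHyp : D.Cor23Hyp) (h23ii : D.Cor23ii) (h23iii : D.Cor23iii) (h23vD : D.Cor23v) :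
    ∀ γ' : W.Corhat, γ' ∈ W.piPM ⊓ W.aug.ker →
      γ' ∈ closure (W.deltaPmBox H : Set W.Corhat) → γ' ∈ W.deltaPmBox H :=
  A.h23v (SubgraphDictionary.of_pi A Dic hHyp h23iii) h23ii h23vD

end StableCurveAgreement

end PlusMinusTower

end Literature.IUT.HodgeArakelov
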